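import Summits.CriticalPhenomena.CardyFormulaZ2.Theorems.CardyIKTransportAnchorByRigidity
import Summits.CriticalPhenomena.CardyFormulaZ2.Theorems.CardyIKTransportIKQuarterTurn
import Summits.CriticalPhenomena.CardyFormulaZ2.Theorems.CardyIKTransportSmirnovCardyTri
import Summits.CriticalPhenomena.CardyFormulaZ2.Theorems.CardyIKTransportCrudeToCanonical
import Summits.CriticalPhenomena.CardyFormulaZ2.Theorems.CardyIKTransportCornerLineDescentOfIKBondBridge

/-!
# The crux `CardyIKTransport.CornerLineDescent` (stmt-CriticalPhenomena-10964): its position INSIDE the route,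
# with the route's proved items discharged

Support file (`--supports stmt-CriticalPhenomena-10964`; lead c13, 2026-08-17).  The route's deciding theorem
`Theses.CardyIKTransport.closes` takes six hypotheses; four of them are PROVED in the tree
(`smirnovCardyTri_proof`, `IKQuarterTurn.IKQuarterTurn_proof`, `anchorByRigidity_proof`, `crudeToCanonical_proof`),
leaving the two open cruxes `IKLinearTransport` (r2, stmt-5076) and `CornerLineDescent` (r3, stmt-10964).  This file
records, kernel-checked and with those four items discharged, what that leaves of r3:

* `cardyIK_of_ikLinearTransport`: r2 alone already yields the HYPOTHESIS of r3 — Cardy for the isotropic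
  Izergin–Korepin gauge in every conformal rectangle (`CardyDiluteOrbit.CardyIK`, stmt-5913, character-for-character
  the antecedent of `CornerLineDescent`) — via Smirnov's theorem, the quarter-turn identity and two-ended rigidity;
* `cornerLineDescent_iff_crudeBondCardy_of_ikLinearTransport`: hence, given r2, the crux r3 is EQUIVALENT to its own
  consequent, Cardy's formula for the crude standard bond-`ℤ²` crossing event in every conformal rectangle (the
  antecedent of the proved `CrudeToCanonical`, i.e. the sub-problem in crude-event form): r3 is not a leaf of the route
  but its entire one-lattice-universality content;
* `cornerLineDescent_iff_ikBondBridge_of_ikLinearTransport`: and, given r2, r3 is equivalent to the sibling route's crux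
  `CardyDiluteOrbit.IKBondBridge` (stmt-5914) — the conditional form `… _of_cardyIK` (p107327) with `CardyIK` discharged
  from r2;
* `cardyFormulaZ2_of_ikLinearTransport_of_cornerLineDescent`: the deciding theorem with its four proved items
  discharged — the route closes the sub-problem from exactly r2 and r3.

No new mathematics (plumbing over landed theorems); recorded so that planners and judges can cite the residual of the
route by name.  References: route file `Theses/CardyIKTransport.lean` (`closes`); `Theses/CardyDiluteOrbit.lean`
(items 5913, 5914); `Theorems/CardyIKTransportCornerLineDescentOfIKBondBridge.lean` (p107327).
-/

namespace Summit.CriticalPhenomena.CardyFormulaZ2.Theorems.CornerLineDescent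

open Literature.Probability.RandomPlanarGeometry
open Summit.CriticalPhenomena.CardyFormulaZ2.Theses

/-- The route's crux r2 `IKLinearTransport` (stmt-5076) already delivers the hypothesis of r3: Cardy's formula for the
isotropic Izergin–Korepin gauge in every conformal rectangle (`CardyDiluteOrbit.CardyIK`, stmt-5913), by two-ended
rigidity (`anchorByRigidity_proof`, item 4969) fed with Smirnov's theorem (`smirnovCardyTri_proof`, item 6432) and the
quarter-turn identity (`IKQuarterTurn_proof`, item 10900) — the first three lines of the route's `closes`. [folklore] -/
theorem cardyIK_of_ikLinearTransport : CardyIKTransport.IKLinearTransport → CardyDiluteOrbit.CardyIK := by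
  intro hlin
  obtain ⟨K, hK⟩ := hlin
  have hA := anchorByRigidity_proof smirnovCardyTri_proof
  specialize hA _ K ?qt hK
  · exact IKQuarterTurn.IKQuarterTurn_proof
  exact hA.2

/-- Given r2 `IKLinearTransport`, the crux r3 `CornerLineDescent` (stmt-10964) is EQUIVALENT to its own consequent:
Cardy's formula for bond percolation on `ℤ²` at `p = ½`, crude embedded crossing event at the standard embedding, in
every conformal rectangle (verbatim the antecedent of the proved support item `CrudeToCanonical`, stmt-4968). [folklore] -/
theorem cornerLineDescent_iff_crudeBondCardy_of_ikLinearTransport : CardyIKTransport.IKLinearTransport → (CardyIKTransport.CornerLineDescent ↔ ∀ R : ConformalRectangle, R.HasCrossingLimit (fun δ ↦ (Literature.Probability.Percolation.bondPercolation (Literature.Probability.LatticeModels.zdGraph 2) Literature.Probability.Percolation.half).real (Literature.Probability.Percolation.embDomainCrossing Literature.Probability.LatticeModels.squareLatticeEmbedding.z R.carrier δ (R.arc 0) (R.arc 2))) cardyFunction) :=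
  fun hlin => ⟨fun h => h (cardyIK_of_ikLinearTransport hlin), fun h _ => h⟩

/-- Given r2 `IKLinearTransport`, the crux r3 `CornerLineDescent` (stmt-10964) is equivalent to the sibling route's crux
`CardyDiluteOrbit.IKBondBridge` (stmt-5914: the crude IK and crude standard bond-`ℤ²` crossing probabilities of every
conformal rectangle differ by `o(1)`): `cornerLineDescent_iff_ikBondBridge_of_cardyIK` (p107327) with `CardyIK`
discharged by `cardyIK_of_ikLinearTransport`. [folklore] -/
theorem cornerLineDescent_iff_ikBondBridge_of_ikLinearTransport : CardyIKTransport.IKLinearTransport → (CardyIKTransport.CornerLineDescent ↔ CardyDiluteOrbit.IKBondBridge) :=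
  fun hlin => cornerLineDescent_iff_ikBondBridge_of_cardyIK (cardyIK_of_ikLinearTransport hlin)

/-- The route's deciding theorem with its four proved items discharged: the sub-problem `CardyFormulaZ2` follows from
exactly the two open cruxes r2 `IKLinearTransport` (stmt-5076) and r3 `CornerLineDescent` (stmt-10964) — r3 turns
`CardyIK` (from r2) into crude bond-`ℤ²` Cardy, and `crudeToCanonical_proof` (item 4968) upgrades crude to canonical. [folklore] -/
theorem cardyFormulaZ2_of_ikLinearTransport_of_cornerLineDescent : CardyIKTransport.IKLinearTransport → CardyIKTransport.CornerLineDescent → _root_.CardyFormulaZ2 :=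
  fun hlin hdesc => crudeToCanonical_proof (hdesc (cardyIK_of_ikLinearTransport hlin))

end Summit.CriticalPhenomena.CardyFormulaZ2.Theorems.CornerLineDescent
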